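import Summits.SmoothPoincare4.SmoothPoincare4.Theses.SblfDescent
import Summits.SmoothPoincare4.SmoothPoincare4.Theorems.SblfDescentRungOne
import Literature.Topology.FourManifolds.SimplifiedBrokenLefschetzFibration

/-!
# `SmoothPoincare4 → RungOne`: the genus-one rung is a sector of the summit (refuter side)

Negative side of crux `SblfDescent.RungOne` (item stmt-SmoothPoincare4-18531, cdisprove cycle 1,
standing disprover file `Cruxes/RungOne/Disproof.lean`).  `RungOne`: a smooth `M ≃ₕ S⁴` carrying
the route's inline `HAS(M, 0)` (a genus-one simplified broken Lefschetz fibration with non-empty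
round locus) is diffeomorphic to `S⁴`.  No new mathematics — kernel-checked bookkeeping for the
planner and the line lead, in the pattern of `Theorems/StepGE3/Negative/OfSmoothPoincare4.lean`:

* `not_smoothPoincare4_of_not_rungOne`, `not_smoothPoincare4_and_not_rungOne` — **the shield,
  stated negatively**: every `M`-instance of the crux is an `M`-instance of the summit statement,
  so a refutation of `RungOne` is an exotic `S⁴` (one that moreover carries a genus-one SBLF).
  This is why the crux resists disproof, unconditionally (no named fact enters, unlike `StepGE3`).
* `rungOne_without_sblf_iff_smoothPoincare4` — **`HAS(M, 0)` is logically idle relative to the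
  summit**: the crux with its SBLF hypothesis deleted is `SmoothPoincare4` VERBATIM; hence no
  sub-clause of `HAS(M, 0)` admits a `_false_without_` lemma unless SPC4 fails.
* `rungOne_iff_smoothPoincare4_of_forall_sblf` — **no slack**: if every smooth homotopy
  4-sphere carried a genus-one SBLF (over the tree's `IsSimplifiedBrokenLefschetzFibration`,
  bridged to the route's inline block by `sblfDescent_has_zero_iff`), the rung would BE the
  summit.  By Baykur–Kamada 2015, Lemma 11 + Cor. 14 that antecedent is itself equivalent to
  SPC4, so the rung's content is exactly the printed classification (fact `B`,
  `nonempty_diffeomorph_sphere_four_of_sblf_genus_one_noLefschetz`).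
* `rungOne_without_homotopyEquiv_false_of_witness`,
  `isEmpty_diffeomorph_sphere_four_of_not_compactSpace` — **`M ≃ₕ S⁴` is load-bearing**, with
  the exact witness obligation: ANY smooth 4-manifold with a genus-one SBLF that is not
  diffeomorphic to `S⁴` (in print: `S² × S² # S¹ × S³`, `CP² # CP²bar # S¹ × S³`, Pao's `L_n`,
  `L'_n`, Baykur–Kamada 2015, Lemma 11; or any NON-COMPACT carrier) refutes the crux with
  `M ≃ₕ S⁴` deleted.  None of these is an object of the tree yet, hence the hypothesis form.

Refuter negative lemmas (crux attack); no Theses decl is asserted unconditionally; statements with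
a clause removed are written inline (no new `def`).
-/

-- `Summit.SmoothPoincare4.SmoothPoincare4.…` (summit = sub-problem) trips `dupNamespace`.
set_option linter.dupNamespace false

noncomputable section

open scoped Manifold ContDiff Topology ContinuousMap

namespace Summit.SmoothPoincare4.SmoothPoincare4.Theorems.RungOne.Negative

open Literature.Topology.FourManifolds
open Summit.SmoothPoincare4.SmoothPoincare4.Theses.SblfDescent

/-! ### The shield (stated negatively: a refutation of the crux is a disproof of SPC4) -/

/-- **`¬ RungOne → ¬ SmoothPoincare4`.**  The crux is the summit statement restricted to the
homotopy 4-spheres carrying `HAS(M, 0)` (same binders, same conclusion, one extra hypothesis,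
which the summit simply ignores), so a counterexample to `RungOne` — a smooth homotopy 4-sphere
with a genus-one SBLF that is not diffeomorphic to `S⁴` — is an exotic `S⁴`.  (The positive
reading `SmoothPoincare4 → RungOne` is the term inside; it is deliberately not exported as a
theorem of its own, being a proof of the item from the summit.) [folklore] -/
theorem not_smoothPoincare4_of_not_rungOne
    (h : ¬ Summit.SmoothPoincare4.SmoothPoincare4.Theses.SblfDescent.RungOne) :
    ¬ _root_.SmoothPoincare4 := by
  intro hS
  exact h (by intro M _ _ _ _ _ e _; exact hS M ‹_› ‹_› e)

/-- **No exotic-`S⁴`-free counterexample**: it is impossible that SPC4 holds and the crux fails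
(the shield as a single negative statement). [folklore] -/
theorem not_smoothPoincare4_and_not_rungOne :
    ¬ (_root_.SmoothPoincare4 ∧ ¬ Summit.SmoothPoincare4.SmoothPoincare4.Theses.SblfDescent.RungOne) :=
  fun h ↦ not_smoothPoincare4_of_not_rungOne h.2 h.1

/-! ### Deleting `HAS(M, 0)`: the summit verbatim -/

/-- **The crux with its SBLF hypothesis deleted is `SmoothPoincare4` verbatim** (the two differ
only in how the atlas binders are written: instance-implicit here, explicit in Mathlib's
`ContinuousMap.HomotopyEquiv.NonemptyDiffeomorphSphere`).  Consequently every weakening of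
`HAS(M, 0)` yields a statement squeezed between `RungOne` and `SmoothPoincare4`: the SBLF
hypothesis carries the METHOD (Hayano / Baykur–Kamada classification), not the truth value.
[folklore] -/
theorem rungOne_without_sblf_iff_smoothPoincare4 :
    (∀ (M : Type) [TopologicalSpace M] [T2Space M] [SecondCountableTopology M]
      [ChartedSpace (EuclideanSpace ℝ (Fin 4)) M] [IsManifold (𝓡 4) ∞ M],
      M ≃ₕ Metric.sphere (0 : EuclideanSpace ℝ (Fin 5)) 1 →
        Nonempty (Diffeomorph (𝓡 4) (𝓡 4) M (Metric.sphere (0 : EuclideanSpace ℝ (Fin 5)) 1) ∞)) ↔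
    _root_.SmoothPoincare4 := by
  constructor
  · intro h M _ _ _ _ _ e
    exact h M e
  · intro hS M _ _ _ _ _ e
    exact hS M ‹_› ‹_› e

/-! ### No slack: universal existence would make the rung equal to the summit -/

/-- **`RungOne ↔ SmoothPoincare4` as soon as every smooth homotopy 4-sphere carries a genus-one
SBLF** (stated over the tree's `IsSimplifiedBrokenLefschetzFibration o f L 0`, which is the
route's inline `HAS(M, 0)` field for field: `sblfDescent_has_zero_iff`).  By Baykur–Kamada
2015, Lemma 11 with Cor. 14 (the only simply connected closed 4-manifold with a genus-one SBLF is
`S⁴`) the antecedent is itself equivalent to SPC4: the rung has no slack on either side — it is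
refutable only by an exotic `S⁴` and provable only through the classification.
[cite: BaykurKamada2015, Lemma 11 and Cor. 14] -/
theorem rungOne_iff_smoothPoincare4_of_forall_sblf
    (hex : ∀ (M : Type) [TopologicalSpace M] [T2Space M] [SecondCountableTopology M]
      [ChartedSpace (EuclideanSpace ℝ (Fin 4)) M] [IsManifold (𝓡 4) ∞ M],
      M ≃ₕ Metric.sphere (0 : EuclideanSpace ℝ (Fin 5)) 1 →
        ∃ (o : SmoothOrientation (𝓡 4) M) (f : M → Metric.sphere (0 : EuclideanSpace ℝ (Fin 3)) 1)
          (L : Finset M), IsSimplifiedBrokenLefschetzFibration o f L 0) :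
    Summit.SmoothPoincare4.SmoothPoincare4.Theses.SblfDescent.RungOne ↔ _root_.SmoothPoincare4 := by
  refine ⟨fun h M _ _ _ _ _ e ↦ ?_, fun hS ↦ ?_⟩
  · exact h M e
      ((Summit.SmoothPoincare4.SmoothPoincare4.Theorems.sblfDescent_has_zero_iff M).mp (hex M e))
  · intro M _ _ _ _ _ e _
    exact hS M ‹_› ‹_› e

/-! ### Deleting `M ≃ₕ S⁴`: load-bearing, with the exact witness obligation -/

/-- **`M ≃ₕ S⁴` is load-bearing.**  Any smooth 4-manifold `W` carrying a genus-one SBLF with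
non-empty round locus (`IsSimplifiedBrokenLefschetzFibration o f L 0`) that is NOT diffeomorphic
to `S⁴` refutes the crux with its homotopy-equivalence hypothesis deleted ("every smooth
4-manifold with a genus-one SBLF is `S⁴`").  Print witnesses: `S² × S² # S¹ × S³`,
`CP² # CP²bar # S¹ × S³`, `L_n`, `L'_n` (`n > 1`) — Baykur–Kamada 2015, Lemma 11 (none is an
object of the tree yet, hence the hypothesis form); non-compact carriers qualify too
(`isEmpty_diffeomorph_sphere_four_of_not_compactSpace`). [cite: BaykurKamada2015, Lemma 11] -/
theorem rungOne_without_homotopyEquiv_false_of_witness (W : Type) [TopologicalSpace W]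
    [T2Space W] [SecondCountableTopology W] [ChartedSpace (EuclideanSpace ℝ (Fin 4)) W]
    [IsManifold (𝓡 4) ∞ W]
    (hW : ∃ (o : SmoothOrientation (𝓡 4) W) (f : W → Metric.sphere (0 : EuclideanSpace ℝ (Fin 3)) 1)
      (L : Finset W), IsSimplifiedBrokenLefschetzFibration o f L 0)
    (hne : IsEmpty (Diffeomorph (𝓡 4) (𝓡 4) W (Metric.sphere (0 : EuclideanSpace ℝ (Fin 5)) 1) ∞)) :
    ¬ ∀ (M : Type) [TopologicalSpace M] [T2Space M] [SecondCountableTopology M]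
        [ChartedSpace (EuclideanSpace ℝ (Fin 4)) M] [IsManifold (𝓡 4) ∞ M],
        (∃ (o : SmoothOrientation (𝓡 4) M) (f : M → Metric.sphere (0 : EuclideanSpace ℝ (Fin 3)) 1)
          (L : Finset M), IsSimplifiedBrokenLefschetzFibration o f L 0) →
        Nonempty (Diffeomorph (𝓡 4) (𝓡 4) M (Metric.sphere (0 : EuclideanSpace ℝ (Fin 5)) 1) ∞) :=
  fun h ↦ hne.elim (h W hW).some

/-- **Non-compact carriers are witnesses for free**: a non-compact `W` is not diffeomorphic to
the (compact) sphere `S⁴`. [folklore] -/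
theorem isEmpty_diffeomorph_sphere_four_of_not_compactSpace (W : Type) [TopologicalSpace W]
    [ChartedSpace (EuclideanSpace ℝ (Fin 4)) W] (hW : ¬ CompactSpace W) :
    IsEmpty (Diffeomorph (𝓡 4) (𝓡 4) W (Metric.sphere (0 : EuclideanSpace ℝ (Fin 5)) 1) ∞) :=
  ⟨fun e ↦ hW e.toHomeomorph.symm.compactSpace⟩

end Summit.SmoothPoincare4.SmoothPoincare4.Theorems.RungOne.Negative

end
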